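import Summits.Langlands.Langlands.Theses.PhantomRMYoshida

/-!
# Route PhantomRMYoshida — Assembly (item stmt-Langlands-13644)

The assembly item of route `route-Langlands-PhantomRMYoshida` for the Langlands summit:
`SerreKWAutomorphicGL2 → StableYoshidaCongruence → ResiduallyYoshidaLifting → PhantomRMJunction →
Langlands` (spelled `∀ _ : SerreKWAutomorphicGL2, …`, definitionally the arrow).

It is pure logic: the statement is literally the curried type of the route file's deciding theorem
`Summit.Langlands.Langlands.Theses.PhantomRMYoshida.closes` — `SerreKWAutomorphicGL2` applied to
`σ̄` and `σ̄'` discharges the GL₂-automorphy hypotheses of `StableYoshidaCongruence`, the sector's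
own `ρ` witnesses its shape hypothesis, the irreducible automorphic `ρ₀` it returns feeds
`ResiduallyYoshidaLifting`, and `PhantomRMJunction` carries the sector to `Langlands` — so the proof
is that theorem.
-/

set_option linter.dupNamespace false -- project-wide option (lakefile weak.linter.dupNamespace); `Summit.Langlands.Langlands` is the mandated namespace (D-0017)

namespace Summit.Langlands.Langlands.Theorems.PhantomRMYoshida

open Summit.Langlands.Langlands.Theses.PhantomRMYoshida

/-- **Assembly of route PhantomRMYoshida** (item stmt-Langlands-13644): the four hypotheses of the
route — Serre–Khare–Wintenberger automorphy on GL₂ in the summit's L-normalisation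
(`SerreKWAutomorphicGL2`), the endoscopic-to-stable congruence (`StableYoshidaCongruence`), relative
automorphy lifting at a residually-Yoshida point in weight (2,2) (`ResiduallyYoshidaLifting`) and
the junction carrying the sector to the summit (`PhantomRMJunction`) — imply `Langlands`.  The proof
unfolds `Assembly` and applies the route's deciding theorem `closes`, whose curried type is exactly
this implication. -/
theorem Assembly_proof : Summit.Langlands.Langlands.Theses.PhantomRMYoshida.Assembly := by
  unfold Summit.Langlands.Langlands.Theses.PhantomRMYoshida.Assembly
  intro hKW hS hL hJ
  exact closes hKW hS hL hJ

end Summit.Langlands.Langlands.Theorems.PhantomRMYoshida
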